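import Summits.Ventures.HodgeRepro2.T5GaloisCartanThree
import Summits.Ventures.HodgeRepro2.T5ResidueFieldFinite
import Summits.Ventures.HodgeRepro2.T5UnramifiedTraceOne

/-!
# The norm of `𝒪_E` over `R₀`, its reduction modulo `𝔭`, and the residue norm surjectivity
(Tier-5 support, N3)

Towards the norm theorem for units of an unramified quadratic extension (the `hnorm` hypothesis of
`T5InertIsotropyOfNormUnits`): this file provides the ALGEBRAIC core.

* `norm_quotient_mk`: for a local ring `R` and a finite free `R`-algebra `S`, the norm commutes with
  reduction modulo the maximal ideal — `N_{(S/𝔭S)/(R/𝔭)}(x mod 𝔭S) = N_{S/R}(x) mod 𝔭`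
  (the norm twin of Mathlib's `Algebra.trace_quotient_mk`, by the same basis argument with
  `RingHom.map_det` in place of `AddMonoidHom.map_trace`).
* (`𝒪_E := integralClosure R₀ E` is finite free over the DVR `R₀`: `T5ResidueFieldFinite` /
  `T5UnramifiedTraceOne`, reused by import.)
* `algebraMap_norm_eq_mul_apply` / `algebraMap_norm_integralClosure`: for a quadratic Galois `E/F`
  with conjugation `σ`, `N_{E/F}(y) = y · σ y` and, for `x ∈ 𝒪_E`, `N_{𝒪_E/R₀}(x) = x · σ x` in `E`
  (Mathlib's `Algebra.norm_eq_prod_automorphisms` with `Gal(E/F) = {1, σ}`, and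
  `Algebra.norm_localization` along `R₀ ⊆ F`, `𝒪_E ⊆ E`).
* `exists_norm_sub_mem_maximalIdeal` / `exists_isInteger_mul_conj_sub_mem`: **every unit of `R₀`
  is a norm modulo `𝔭`** — for every `u ∈ R₀` there is `y ∈ 𝒪_E` with `N(y) − u ∈ 𝔭` (Mathlib's
  `FiniteField.norm_surjective` on the finite residue fields `R₀/𝔭 ⊆ 𝒪_E/𝔭𝒪_E`, transported by
  `norm_quotient_mk`; `𝒪_E/𝔭𝒪_E` is a field because `𝔭𝒪_E = 𝔭_E` at an inert place and finite by
  `T5ResidueFieldFinite`).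

The lifting of this residue statement to an exact norm (Hensel's lemma on a henselian `R₀`) is the
next file. No L-value anywhere (README §8(d): NO).
-/

namespace Summit.Ventures.HodgeRepro2.T5NormQuotientMk

open IsLocalRing

section General

variable {R S : Type*} [CommRing R] [CommRing S] [Algebra R S] [Module.Free R S] [Module.Finite R S]
  [IsLocalRing R]

attribute [local instance] Ideal.Quotient.field

/-- The norm commutes with reduction modulo the maximal ideal of a local ring (finite free
algebras) — the norm twin of `Algebra.trace_quotient_mk`. -/
theorem norm_quotient_mk (x : S) :
    Algebra.norm (R ⧸ maximalIdeal R)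
        (Ideal.Quotient.mk (Ideal.map (algebraMap R S) (maximalIdeal R)) x) =
      Ideal.Quotient.mk (maximalIdeal R) (Algebra.norm R x) := by
  classical
  let b : Module.Basis (Module.Free.ChooseBasisIndex R S) R S := Module.Free.chooseBasis R S
  rw [Algebra.norm_eq_matrix_det b, Algebra.norm_eq_matrix_det (basisQuotient b), RingHom.map_det]
  congr 1
  ext i j
  simp only [Algebra.leftMulMatrix_apply, Algebra.coe_lmul_eq_mul, LinearMap.toMatrix_apply,
    basisQuotient_apply, LinearMap.mul_apply', RingHom.mapMatrix_apply, Matrix.map_apply,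
    ← map_mul, basisQuotient_repr]

end General


section Norm

variable {R₀ F E : Type*} [CommRing R₀] [IsDomain R₀] [IsDiscreteValuationRing R₀] [Field F]
  [Field E] [Algebra R₀ F] [IsFractionRing R₀ F] [Algebra F E] [Algebra R₀ E]
  [IsScalarTower R₀ F E] [FiniteDimensional F E] [Algebra.IsSeparable F E]

omit [IsDomain R₀] [IsDiscreteValuationRing R₀] [IsFractionRing R₀ F] [IsScalarTower R₀ F E]
  [Algebra.IsSeparable F E] in
open scoped Classical in
/-- `Gal(E/F) = {1, σ}` for a quadratic Galois extension with `σ ≠ 1`. -/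
theorem univ_eq_pair [IsGalois F E] (h2 : Module.finrank F E = 2) (σ : E ≃ₐ[F] E) (hσ : σ ≠ 1) :
    (Finset.univ : Finset (E ≃ₐ[F] E)) = {1, σ} := by
  refine (Finset.eq_univ_of_card _ ?_).symm
  rw [Finset.card_pair hσ.symm, ← Nat.card_eq_fintype_card, IsGalois.card_aut_eq_finrank, h2]

omit [IsDomain R₀] [IsDiscreteValuationRing R₀] [IsFractionRing R₀ F] [IsScalarTower R₀ F E]
  [Algebra.IsSeparable F E] in
open scoped Classical in
/-- `N_{E/F}(y) = y · σ y`. -/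
theorem algebraMap_norm_eq_mul_apply [IsGalois F E] (h2 : Module.finrank F E = 2) (σ : E ≃ₐ[F] E)
    (hσ : σ ≠ 1) (y : E) : algebraMap F E (Algebra.norm F y) = y * σ y := by
  rw [Algebra.norm_eq_prod_automorphisms, univ_eq_pair h2 σ hσ, Finset.prod_pair hσ.symm,
    AlgEquiv.one_apply]

include F in
/-- For `x ∈ 𝒪_E`, `N_{𝒪_E/R₀}(x) = x · σ x` in `E`. -/
theorem algebraMap_norm_integralClosure [IsGalois F E] (h2 : Module.finrank F E = 2)
    (σ : E ≃ₐ[F] E) (hσ : σ ≠ 1) (x : integralClosure R₀ E) :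
    algebraMap R₀ E (Algebra.norm R₀ x) = (x : E) * σ x := by
  haveI : IsLocalization
      (Algebra.algebraMapSubmonoid (integralClosure R₀ E) (nonZeroDivisors R₀)) E :=
    IsIntegralClosure.isLocalization R₀ F E (integralClosure R₀ E)
  haveI := T5UnramifiedTraceOne.module_free_integralClosure R₀ F E
  haveI := T5ResidueFieldFinite.module_finite_integralClosure R₀ F E
  have h := Algebra.norm_localization R₀ (S := integralClosure R₀ E) (Rₘ := F) (Sₘ := E)
    (nonZeroDivisors R₀) x
  rw [IsScalarTower.algebraMap_apply R₀ F E, ← h, algebraMap_norm_eq_mul_apply h2 σ hσ]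
  rfl

end Norm

section Residue

variable {R₀ F E : Type*} [CommRing R₀] [IsDomain R₀] [IsDiscreteValuationRing R₀] [Field F]
  [Field E] [Algebra R₀ F] [IsFractionRing R₀ F] [Algebra F E] [Algebra R₀ E]
  [IsScalarTower R₀ F E] [FiniteDimensional F E] [Algebra.IsSeparable F E]
  [IsLocalRing (integralClosure R₀ E)] [Finite (ResidueField R₀)]

attribute [local instance] Ideal.Quotient.field

include F in
/-- **Every element of `R₀` is a norm modulo `𝔭`** at an inert place: for `u ∈ R₀` there is
`y ∈ 𝒪_E` with `N_{𝒪_E/R₀}(y) − u ∈ 𝔭` (the residue fields are finite, `𝒪_E/𝔭𝒪_E` is a field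
because `𝔭𝒪_E = 𝔭_E`, and the norm of finite fields is surjective). -/
theorem exists_norm_sub_mem_maximalIdeal
    (hunr : Ideal.map (algebraMap R₀ (integralClosure R₀ E)) (maximalIdeal R₀) =
      maximalIdeal (integralClosure R₀ E)) (u : R₀) :
    ∃ y : integralClosure R₀ E, Algebra.norm R₀ y - u ∈ maximalIdeal R₀ := by
  haveI : (Ideal.map (algebraMap R₀ (integralClosure R₀ E)) (maximalIdeal R₀)).IsMaximal := by
    rw [hunr]; infer_instance
  haveI := T5UnramifiedTraceOne.module_free_integralClosure R₀ F E
  haveI := T5ResidueFieldFinite.module_finite_integralClosure R₀ F E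
  haveI := T5ResidueFieldFinite.finite_quotient_map_maximalIdeal R₀ F E
  obtain ⟨yb, hyb⟩ := FiniteField.norm_surjective (R₀ ⧸ maximalIdeal R₀)
    (↥(integralClosure R₀ E) ⧸ Ideal.map (algebraMap R₀ (integralClosure R₀ E)) (maximalIdeal R₀))
    (Ideal.Quotient.mk (maximalIdeal R₀) u)
  obtain ⟨y, rfl⟩ := Ideal.Quotient.mk_surjective yb
  refine ⟨y, ?_⟩
  rw [← Ideal.Quotient.eq, ← norm_quotient_mk, hyb]

/-- The same in `E` with the Galois conjugation: for `u ∈ R₀` there are `y ∈ 𝒪_E` and `r ∈ R₀` with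
`y · σ y = r` and `r − u ∈ 𝔭`. -/
theorem exists_isInteger_mul_conj_sub_mem [IsGalois F E] (h2 : Module.finrank F E = 2)
    (σ : E ≃ₐ[F] E) (hσ : σ ≠ 1)
    (hunr : Ideal.map (algebraMap R₀ (integralClosure R₀ E)) (maximalIdeal R₀) =
      maximalIdeal (integralClosure R₀ E)) (u : R₀) :
    ∃ (y : E) (r : R₀), IsLocalization.IsInteger (integralClosure R₀ E) y ∧
      y * σ y = algebraMap R₀ E r ∧ r - u ∈ maximalIdeal R₀ := by
  obtain ⟨y, hy⟩ := exists_norm_sub_mem_maximalIdeal (F := F) hunr u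
  exact ⟨y, Algebra.norm R₀ y, ⟨y, rfl⟩, (algebraMap_norm_integralClosure h2 σ hσ y).symm, hy⟩

end Residue

end Summit.Ventures.HodgeRepro2.T5NormQuotientMk
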